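import Literature.AlgebraicGeometry.FundamentalGroup.ZariskiOpenCoveringConnected
import Literature.AlgebraicGeometry.HodgeTheory.HodgeGenericQbarDescentFiniteMonodromyProofs
import Literature.AlgebraicGeometry.HodgeTheory.SupportedLocusClosed
import Literature.AlgebraicGeometry.HodgeTheory.QbarFamilyLocalSystem
import Literature.AlgebraicGeometry.HodgeTheory.HodgeGenericQbarDescentCompactification
import HarnessLib

/-!
# Flat continuations along loops may be realised by loops inside any dense Zariski open

Topic `Literature/AlgebraicGeometry/HodgeTheory`, on the real carriers of `HodgeLocus.lean`
(`FiberClass f k`, the espace étalé of `Rᵏ f_* ℂ`; `IsContinuationAlong γ α β`). For a family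
`f : 𝒳 ⟶ S` of `ℂ`-schemes which is cohomologically locally trivial over `S(ℂ)` (e.g. smooth
projective, by Ehresmann), with `S` an integral `ℂ`-scheme smooth of relative dimension `n`, a proper
Zariski-closed `Z ⊊ S`, a point `s ∈ S(ℂ)` off `Z` and classes `α, β ∈ Hᵏ(𝒳_s(ℂ); ℂ)`:
**if `β` is the flat continuation of `α` along SOME loop at `s`, it is its continuation along a loop
at `s` contained in `(S ∖ Z)(ℂ)`** (`IsContinuationAlong.exists_loop_forall_pt_notMem`). This is the
monodromy-level form of the surjectivity `π₁((S ∖ Z)(ℂ)) ↠ π₁(S(ℂ))` (the tree's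
`FundamentalGroup.isPathConnected_preimage_setOf_pt_notMem`, applied to the covering of `S(ℂ)` by the
path component of `(s, α)` in the espace étalé, `isCoveringMap_restrict_pathComponent` with
`isCoveringMap_fiberClassPt`): monodromy orbits, their finiteness, the type of the continuations of a
class — everything the Hodge-locus statements at a point see of `π₁` — do not change when the smooth
base is shrunk to a dense Zariski open. The `ℚ̄`-family form (`…_of_qbarFamily`: `S = S₀ ⊗_σ ℂ` with
`S₀` smooth irreducible quasi-projective over `ℚ̄`, `f = f₀ ⊗_σ ℂ` a smooth projective family, `Z`
the preimage of a proper closed `Z₀ ⊊ S₀`, `s` a `ℚ̄`-GENERIC point — which lies off every such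
`Z`) is the shape in which type-stability / finite-monodromy statements at `ℚ̄`-generic points
(Voisin 2007, §3) are localised on the base.

Everything is proved; no definitions, no named facts.

## References

* [Voisin2007HodgeLoci] C. Voisin, Hodge loci and absolute Hodge classes, Compositio Math. 143
  (2007), §3.
* [VoisinHodgeI2002] C. Voisin, Hodge Theory and Complex Algebraic Geometry I, CUP 2002, §9.2.1.
* [SGA1] A. Grothendieck, M. Raynaud, SGA 1, Exp. V Prop. 8.2 (the étale analogue).
-/

noncomputable section

open CategoryTheory AlgebraicGeometry Set Topology
open Literature.Topology.CoveringSpaces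

namespace Literature.AlgebraicGeometry.HodgeTheory

section General

variable {𝒳 S : Motives.SchemeOver ℂ} (f : 𝒳 ⟶ S) (k : ℕ)

/-- **A flat continuation along a loop is a flat continuation along a loop avoiding any proper
Zariski-closed subset** (base `S` integral, smooth of relative dimension `n` over `ℂ`; `Rᵏ f_* ℂ` a
local system over `S(ℂ)`; the base point off `Z`). Proof: the path component `C` of `(s, α)` in the
espace étalé `FiberClass f k` is a connected covering of `S(ℂ)`
(`isCoveringMap_restrict_pathComponent`, `isCoveringMap_fiberClassPt`), so its part over
`(S ∖ Z)(ℂ)` is path connected (`FundamentalGroup.isPathConnected_preimage_setOf_pt_notMem`); it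
contains `(s, α)` and `(s, β)`, and a path joining them there projects to the required loop.
[cite: Voisin2007HodgeLoci, §3] [cite: VoisinHodgeI2002, §9.2.1] -/
theorem IsContinuationAlong.exists_loop_forall_pt_notMem {n : ℕ} [IsIntegral S.left]
    [SmoothOfRelativeDimension n S.hom] [LocallyPathConnectedSpace (Motives.ComplexPoints S)]
    (hU : IsCohomologicallyLocallyTrivialOn f (univ : Set (Motives.ComplexPoints S)))
    {Z : Set S.left} (hZ : IsClosed Z) (hZ' : Z ≠ univ) {s : Motives.ComplexPoints S}
    (hs : s.pt ∉ Z) {α β : complexBetti (Motives.fiberOver f s) k} {γ : Path s s}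
    (h : IsContinuationAlong γ α β) :
    ∃ γ' : Path s s, (∀ u, (γ' u).pt ∉ Z) ∧ IsContinuationAlong γ' α β := by
  -- the path component of `(s, α)`, a connected, locally path connected covering of `S(ℂ)`
  set x₀ : FiberClass f k := ⟨s, α⟩ with hx₀
  have hq := isCoveringMap_restrict_pathComponent (isCoveringMap_fiberClassPt f k hU) x₀
  haveI := connectedSpace_pathComponent x₀
  haveI : LocallyPathConnectedSpace (pathComponent x₀) :=
    FundamentalGroup.locallyPathConnectedSpace_of_isLocalHomeomorph hq.isLocalHomeomorph
  have hconn := FundamentalGroup.isPathConnected_preimage_setOf_pt_notMem (n := n) hZ hZ'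
    hq.isLocalHomeomorph
  -- `(s, β)` lies in that component (the lift `Γ` of `γ` joins it to `(s, α)`), over `s ∉ Z`
  obtain ⟨Γ, -⟩ := h
  have hβ : (⟨s, β⟩ : FiberClass f k) ∈ pathComponent x₀ := ⟨Γ⟩
  obtain ⟨P, hP⟩ : JoinedIn {c : pathComponent x₀ | ((pathComponent x₀).restrict FiberClass.pt c).pt ∉ Z}
      ⟨x₀, mem_pathComponent_self x₀⟩ ⟨⟨s, β⟩, hβ⟩ :=
    hconn.joinedIn _ hs _ hs
  -- project the joining path to a loop of `S(ℂ)` avoiding `Z`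
  let γ' : Path s s :=
    { toFun := fun u ↦ (P u).1.pt
      continuous_toFun :=
        (FiberClass.continuous_pt f k).comp (continuous_subtype_val.comp P.continuous)
      source' := by rw [P.source]
      target' := by rw [P.target] }
  exact ⟨γ', fun u ↦ hP u, ⟨P.map continuous_subtype_val, fun _ ↦ rfl⟩⟩

end General

section QbarFamily

/-- **At a `ℚ̄`-generic point, flat continuations along loops are continuations along loops inside
any dense `ℚ̄`-Zariski open.** For `σ : ℚ̄ →+* ℂ`, a `ℚ̄`-morphism `f₀ : 𝒳₀ ⟶ S₀` onto a smooth
irreducible quasi-projective `S₀` whose complexification `f = f₀ ⊗_σ ℂ` is a smooth projective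
family of relative dimension `n`, a proper closed `Z₀ ⊊ S₀`, a point `s` of `S = S₀ ⊗_σ ℂ` over the
generic point of `S₀` and `β` a continuation of `α ∈ Hᵏ(𝒳_s(ℂ); ℂ)` along a loop at `s`: `β` is a
continuation of `α` along a loop at `s` all of whose points lie over `S₀ ∖ Z₀`. (`S` is integral and
smooth of some pure dimension, `Rᵏ f_* ℂ` is a local system on `S(ℂ)` —
`isCohomologicallyLocallyTrivialOn_univ_baseChangeHom` — and `s` lies over no point of `Z₀`, whose
closure would otherwise be all of `S₀`.) [cite: Voisin2007HodgeLoci, §3] -/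
theorem IsContinuationAlong.exists_loop_forall_base_pt_notMem_of_qbarFamily
    (σ : AlgebraicClosure ℚ →+* ℂ) {𝒳₀ S₀ : Motives.SchemeOver (AlgebraicClosure ℚ)}
    (f₀ : 𝒳₀ ⟶ S₀) {n : ℕ} (k : ℕ) (hS₀ : IsQuasiProjectiveOver S₀) [IrreducibleSpace S₀.left]
    [Smooth S₀.hom] (hf : Motives.IsSmoothProjectiveFamily ((Motives.baseChangeHom σ).map f₀) n)
    {Z₀ : Set S₀.left} (hZ₀ : IsClosed Z₀) (hZ₀' : Z₀ ≠ univ)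
    {s : Motives.ComplexPoints ((Motives.baseChangeHom σ).obj S₀)}
    (hgen : closure {(Motives.baseChangeHomFst σ S₀).base s.pt} = (univ : Set S₀.left))
    {α β : complexBetti (Motives.fiberOver ((Motives.baseChangeHom σ).map f₀) s) k} {γ : Path s s}
    (h : IsContinuationAlong γ α β) :
    ∃ γ' : Path s s, (∀ u, (Motives.baseChangeHomFst σ S₀).base (γ' u).pt ∉ Z₀) ∧
      IsContinuationAlong γ' α β := by
  -- `S = S₀ ⊗_σ ℂ` is smooth of some pure dimension, irreducible, reduced, hence integral
  obtain ⟨d, hd⟩ := exists_smoothOfRelativeDimension_baseChangeHom σ S₀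
  haveI := hd
  haveI : Smooth ((Motives.baseChangeHom σ).obj S₀).hom := SmoothOfRelativeDimension.smooth d _
  haveI : IrreducibleSpace ((Motives.baseChangeHom σ).obj S₀).left :=
    irreducibleSpace_baseChangeHom_left σ
  haveI : IsReduced ((Motives.baseChangeHom σ).obj S₀).left :=
    Motives.isReduced_of_smooth_over_field ((Motives.baseChangeHom σ).obj S₀).hom
  haveI : IsIntegral ((Motives.baseChangeHom σ).obj S₀).left :=
    isIntegral_of_irreducibleSpace_of_isReduced _
  haveI : LocallyOfFiniteType ((Motives.baseChangeHom σ).obj S₀).hom := inferInstance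
  haveI : LocallyPathConnectedSpace (Motives.ComplexPoints ((Motives.baseChangeHom σ).obj S₀)) :=
    locallyPathConnectedSpace_complexPoints_of_smooth _
  -- the preimage `Z` of `Z₀`: closed, proper (the projection `S → S₀` is onto), and `s ∉ Z`
  have hZ : IsClosed ((Motives.baseChangeHomFst σ S₀).base ⁻¹' Z₀) :=
    hZ₀.preimage (Motives.baseChangeHomFst σ S₀).base.hom.continuous
  have hZ' : (Motives.baseChangeHomFst σ S₀).base ⁻¹' Z₀ ≠ univ := by
    intro hZu
    apply hZ₀'
    refine eq_univ_of_forall fun z ↦ ?_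
    obtain ⟨y, rfl⟩ := (surjective_baseChangeHomFst σ S₀).surj z
    exact (hZu ▸ mem_univ y : y ∈ (Motives.baseChangeHomFst σ S₀).base ⁻¹' Z₀)
  have hs : s.pt ∉ (Motives.baseChangeHomFst σ S₀).base ⁻¹' Z₀ := by
    intro hsZ
    apply hZ₀'
    have hsub : closure {(Motives.baseChangeHomFst σ S₀).base s.pt} ⊆ Z₀ :=
      hZ₀.closure_subset_iff.2 (singleton_subset_iff.2 hsZ)
    rw [hgen] at hsub
    exact univ_subset_iff.1 hsub
  exact IsContinuationAlong.exists_loop_forall_pt_notMem ((Motives.baseChangeHom σ).map f₀) k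
    (n := d) (isCohomologicallyLocallyTrivialOn_univ_baseChangeHom σ f₀ hf hS₀) hZ hZ' hs h

end QbarFamily

end Literature.AlgebraicGeometry.HodgeTheory

end
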